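import Mathlib

/-!
# BirchSwinnertonDyer — rank ≥ 2 observatory: the abstract saturation-sieve criterion (anom seat, gen 9, instrument J11 `satB`)

HONEST FRAMING: per-curve certified theorems and census instruments; no claim on BSD in rank ≥ 2.

This file is NOT census data: it is the (elementary) group-theoretic lemma that every `satB` certificate instantiates, kernel-checked once
in the abstract so that the per-curve certificates only have to exhibit finite data.

Setting of the certificates (informal dictionary; nothing below depends on elliptic curves): `A = E(ℚ)`, `H = G + T` with `G` the subgroup
generated by the table generators and `T` the FULL torsion subgroup, `p` a prime, and for finitely many good primes `ℓ` the homomorphisms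
`φ_ℓ : E(ℚ) → E(𝔽_ℓ) → S_p(ℓ)/p S_p(ℓ)` (`S_p(ℓ)` the `p`-Sylow subgroup of `E(𝔽_ℓ)`, the second arrow multiplication by the prime-to-`p` part of
`#E(𝔽_ℓ)`); each `φ_ℓ` kills `p • E(ℚ)`, all `p`-torsion of `E(ℚ)` lies in `T ⊆ H`, and "the stacked coordinate matrix has rank `r + dim T/pT`"
is exactly hypothesis `hinj` (an element of `H` killed by every `φ_ℓ` is `p` times an element of `H`).  Conclusion: `H` is `p`-saturated in
`E(ℚ)`, hence (second theorem) `p` does not divide the index `[E(ℚ) : H]` when that index is finite.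
Source of the method: S. Siksek, *Infinite descent on elliptic curves*, Rocky Mountain J. Math. 25 (1995) 1501–1538, doi:10.1216/rmjm/1181072159
(the saturation sieve used by Cremona's `mwrank`); the census use is documented in
`run/shared/lean/b2b/bsd-rank2-observatory/b2b-bsdr2-anom/CONSISTENCY-JOINS.md` §J11.
-/

namespace Summit.BirchSwinnertonDyer.BirchSwinnertonDyer.Rank2Observatory.SaturationSieve

variable {A : Type*} [AddCommGroup A]

-- "`H` is `p`-saturated in `A`" is spelled out as `∀ a : A, p • a ∈ H → a ∈ H` in every statement (no auxiliary `def : Prop`).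

/-- **Abstract saturation-sieve criterion.**  Let `φ i : A →+ W i` be homomorphisms killing `p • A`, suppose every `p`-torsion element of `A`
lies in `H`, and suppose that an element of `H` killed by every `φ i` is `p` times an element of `H`.  Then `H` is `p`-saturated in `A`. -/
theorem isSaturatedAt_of_sieve {ι : Type*} {W : ι → Type*} [∀ i, AddCommGroup (W i)]
    (H : AddSubgroup A) (p : ℕ) (φ : ∀ i, A →+ W i)
    (hkill : ∀ i (a : A), φ i (p • a) = 0)
    (htors : ∀ a : A, p • a = 0 → a ∈ H)
    (hinj : ∀ h ∈ H, (∀ i, φ i h = 0) → ∃ h' ∈ H, h = p • h') :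
    ∀ a : A, p • a ∈ H → a ∈ H := by
  intro a ha
  obtain ⟨h', hh'H, hh'⟩ := hinj (p • a) ha (fun i => hkill i a)
  have hz : p • (a - h') = 0 := by rw [smul_sub, ← hh', sub_self]
  have hmem : a - h' ∈ H := htors (a - h') hz
  have : a = (a - h') + h' := by abel
  rw [this]
  exact H.add_mem hmem hh'H

/-- The one-homomorphism form (take `Φ` = the product of the `φ_ℓ`). -/
theorem isSaturatedAt_of_hom {W : Type*} [AddCommGroup W]
    (H : AddSubgroup A) (p : ℕ) (Φ : A →+ W)
    (hkill : ∀ a : A, Φ (p • a) = 0)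
    (htors : ∀ a : A, p • a = 0 → a ∈ H)
    (hinj : ∀ h ∈ H, Φ h = 0 → ∃ h' ∈ H, h = p • h') :
    ∀ a : A, p • a ∈ H → a ∈ H :=
  isSaturatedAt_of_sieve (ι := Unit) (W := fun _ => W) H p (fun _ => Φ) (fun _ a => hkill a) htors
    (fun h hh hz => hinj h hh (hz ()))

/-- A `p`-saturated subgroup of finite index has index prime to `p` (Cauchy's theorem in `A ⧸ H`). -/
theorem not_dvd_index_of_isSaturatedAt (H : AddSubgroup A) {p : ℕ} (hp : p.Prime) [H.FiniteIndex]
    (hsat : ∀ a : A, p • a ∈ H → a ∈ H) : ¬ p ∣ H.index := by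
  intro hdvd
  haveI : Fact p.Prime := ⟨hp⟩
  haveI : Finite (A ⧸ H) := AddSubgroup.finite_quotient_of_finiteIndex
  have hcard : p ∣ Nat.card (A ⧸ H) := by simpa [AddSubgroup.index] using hdvd
  obtain ⟨x, hx⟩ := exists_prime_addOrderOf_dvd_card' (G := A ⧸ H) p hcard
  obtain ⟨a, rfl⟩ := QuotientAddGroup.mk_surjective x
  have hpa : p • (QuotientAddGroup.mk a : A ⧸ H) = 0 := by
    rw [← hx]; exact addOrderOf_nsmul_eq_zero _
  have hmem : p • a ∈ H := by
    rw [← QuotientAddGroup.eq_zero_iff]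
    simpa using hpa
  have ha : a ∈ H := hsat a hmem
  have hzero : (QuotientAddGroup.mk a : A ⧸ H) = 0 := (QuotientAddGroup.eq_zero_iff a).mpr ha
  rw [hzero, addOrderOf_zero] at hx
  exact hp.one_lt.ne' hx.symm

end Summit.BirchSwinnertonDyer.BirchSwinnertonDyer.Rank2Observatory.SaturationSieve
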